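import Summits.ResolutionOfSingularities.ResolutionOfSingularities.Theorems.HironakaBridgeLinks

/-!
# Route `Descent`, item `HironakaBridgePrimeToFG` (stmt-ResolutionOfSingularities-19708): PROVED

OURS rung B, step B1 (plan/RUNG-B.md v0.2; cell res-hironaka; not a statement of any manuscript, no
candidate asserted): resolution of every reduced separated scheme of finite type over the PRIME field
`ZMod p` implies resolution over every field finitely generated over it (`L = Subfield.closure t ⊆ k`,
`k` of characteristic `p`): spread out over a finitely generated `𝔽_p`-algebra `R ⊆ L` with
`Frac R = L`, resolve the model over `𝔽_p`, take the generic fibre. The statement is verbatim the item's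
signature; the proof is `Theorems.fgLevelRes_of_primeFieldRes` (`HironakaBridgeLinks.lean`; the proof of
`Theorems.stub_levelResolution` run with its hypothesis at `ZMod p` only).
-/

noncomputable section

set_option linter.dupNamespace false -- mandated namespace of this single-conjunct summit

namespace Summit.ResolutionOfSingularities.ResolutionOfSingularities.Theorems

/-- **Item `HironakaBridgePrimeToFG` (stmt-ResolutionOfSingularities-19708), proved**: resolution over
`ZMod p` ⇒ resolution over every finitely generated field of characteristic `p` (spreading out and
generic fibre; `Theorems.fgLevelRes_of_primeFieldRes`). [folklore] -/
theorem hironakaBridgePrimeToFG_proof : ∀ (p : ℕ) [Fact p.Prime], (∀ (X : AlgebraicGeometry.Scheme.{0}) (f : X ⟶ AlgebraicGeometry.Spec (.of (ZMod p))), AlgebraicGeometry.IsSeparated f → AlgebraicGeometry.LocallyOfFiniteType f → AlgebraicGeometry.QuasiCompact f → AlgebraicGeometry.IsReduced X → Literature.AlgebraicGeometry.Resolution.Scheme.HasResolution X) → ∀ (k : Type) [Field k] [CharP k p] (L : Subfield k) (t : Finset k), L = Subfield.closure (↑t : Set k) → ∀ (Z : AlgebraicGeometry.Scheme.{0}) (g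 : Z ⟶ AlgebraicGeometry.Spec (.of L)), AlgebraicGeometry.IsSeparated g → AlgebraicGeometry.LocallyOfFiniteType g → AlgebraicGeometry.QuasiCompact g → AlgebraicGeometry.IsReduced Z → Literature.AlgebraicGeometry.Resolution.Scheme.HasResolution Z :=
  fun p _ => fgLevelRes_of_primeFieldRes p

end Summit.ResolutionOfSingularities.ResolutionOfSingularities.Theorems

end
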